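/-
Copyright (c) 2026 the pub-hodgecm-mathlib formalisation cell (harness21).  Prover seat hodgecm-mathlib-F0P3a-p01 (g39), explicit-unit SUPPORTS-ONLY on h413, req620 Track A
«(D-RAM) FOUR-FRAME» squad ((β₂) road (R-36), lane A (Unr-K): a NEGATIVE STRUCTURAL FACT for the lane-A per-cell road — the type-U frame carries NO integral Θ-FIXED chart
point `κ₀` of the line `Tr_ρ = 1`; sequel of ★ p864540 `…UnrKFrameClassLetters`), 2026-09-05.
-/
import Summits.HodgeConjecture.HodgeConjecture.Theorems.F0P3cDyRamUnrKFrameClassLetters   -- ★ p864540 (this lineage, g38): the type-U class letters; brings ★ `…TypeUBottomFacts`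
import HarnessLib

/-!
# Crux `H413`, line LH4 «(D-RAM) FOUR-FRAME» — (β₂) road, lane A (type U ∕ Unr-K): «NO Θ-FIXED INTEGRAL CHART ON TYPE U» —
# `Θρ` is residually trivial, hence no `κ₀ ∈ Fix Θ` with `κ₀ + ρκ₀ = 1` and `|κ₀| ≤ 1`

Cell `hodgecm-mathlib` (D-0151), FLOOR 0, crux item H413 = `stmt-HodgeConjecture-24833`, route of record `HCCMUnconditional`; squad F0∕P3c∕LH4; lane
`--supports stmt-HodgeConjecture-24833 --as helper` (count-neutral; pays NO tier-0 row).  THEOREMS ONLY (no `def`, no instance, no notation, no `sorry`, default heartbeats);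
★-only imports; states NO census law; (β₂) stays a HYPOTHESIS.  ABSTRACT one-field frame of TYPE U (lane A), letters ⊆ ‹OFF-A.letter.v2›'s: `ρ`, `Θ` isometric involutions
of a `ℤᵐ⁰`-valued field `M`, `ρα ≠ α`, `|α| ≤ 1`, the integrality letter `_hint` (`|z| ≤ 1 ⇒ |(z − ρz)∕(α − ρα)| ≤ 1`), the type-U case-definer `_hτ : |ρα − Θα| < 1`, the residual
letter `_hσres` (`ρz = z`, `|z| ≤ 1 ⇒ |Θz − z| < 1`), and `|2| < 1` (⟸ `_h2 : ¬ IsUnit (2 : 𝒪[E])` through `_hjiso`, ★ `v_two_lt_one_of_not_isUnit_two`).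

WHY (LANE-A BOARD v4 §1; K6 DESK WORD #14 architecture; β₂ sub-dealer LH4-p04 (g10) 02:41:09Z (ii) «lane A: the same spine + K6-0 instances on the tower and the head»).  The
lane-B (RamK) per-cell road reads every row∕line cell through a CHART `(κ₀, ξ₀) ⊂ Fix Θ` of the line `Tr_ρ = 1`: the 35 ★ chart files (★ `…RowInsideChartLetters`, ★ W2
`…UpperRayCellLetters.exists_cellLetters`, ★ `…LowerLineCellLetters`, ★ F1a∕F1b `…RowTowerVertexLetters`∕`…RowTowerCellPerCellValue`, DICT-NX∕M1-NX, …) carry the letters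
`(hκ₀ : κ₀ + ρ κ₀ = 1) (hΘκ₀ : Θ κ₀ = κ₀) (hκ₀1 : Valued.v κ₀ ≤ 1)`, supplied in lane B by ★ p864373 `exists_refPair_of_frame` from the third field `Fix Θ` with its
UNRAMIFIED involution `ρ|`.  THIS FILE shows that on TYPE U these three letters are JOINTLY UNSATISFIABLE: §1 `v_theta_rho_sub_self_lt_one` — `Θρ` is RESIDUALLY TRIVIAL on
type U (`|z| ≤ 1 ⇒ |Θ(ρz) − z| < 1`: coordinates `z = p + q·α` over `Fix ρ` by `_hint`, then `_hσres` on `p`, `q` and `_hτ` on `α`); §2 HEAD `one_lt_v_of_theta_fixed_of_add_map_eq_one` —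
`Θκ₀ = κ₀ ∧ κ₀ + ρκ₀ = 1 ⇒ 1 < |κ₀|` (else §1 at `κ₀` reads `|1 − 2κ₀| < 1`, while `|2κ₀| < 1` forces `|1 − 2κ₀| = 1`); §3 `not_exists_theta_fixed_integral_chart` — the
negation of the chart letters, byte-shaped as ★ `…RowInsideChartLetters`' first three conjuncts.  (Equivalently: in lane A `Fix Θ = K♮` is the RAMIFIED quadratic third field
— ★ `exists_thirdFieldPackage_unr` gives it a `ρ|`-uniformiser of depth `d` — and a wild ramified quadratic extension has no integer of trace `1` (Serre III §3); the proof
here is the two-line residual one and needs no residue field.)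
CONSEQUENCE (routing, not a theorem): no lane-B chart file instantiates in lane A as it stands; the lane-A per-cell road (‹CORE-A› ★ p864824's socket, ‹PRODBAL-U-A›,
‹EVENODD-A›, the RAY letters) needs charts in the OTHER third field `Fix (Θρ)` — UNRAMIFIED over `F` on type U, where `Θ` acts as `ρ`: `Θκ₀ = 1 − κ₀`, `Θξ₀ = −ξ₀` — i.e.
the RamK third-field package ★ `exists_thirdFieldPackage_ramK` ∕ ★ `exists_refPair_of_frame` applied to the involution `Θ ∘ ρ` (type-U letters ⇒ its RamK letters:
`|α − Θρα| < 1` = `_hτ`, `_hσres` verbatim, `|jEϖ − Θρ(jEϖ)| = |jEϖ|^d` = `_hddE`), once `IsRamifiedQuadraticDatum (Θ ∘ ρ) (jE ϖ) d tE` is typed from the lane-A letters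
(the even-order clause for `Fix (Θρ)` is the one non-trivial input).
HONEST LABEL.  Count-neutral local algebra; nothing printed is asserted; no census law is stated; the lane-A letters and (β₂) `stub_law_cleanSgn₂` stay HYPOTHESES ∕ UNPROVED;
`HC_CM` is proved only modulo the 7 printed citations (2 remaining named inputs: hLiu418 = `stmt-HodgeConjecture-24832`, h413 = `stmt-HodgeConjecture-24833`) until rung 0 closes.
## References
* [Serre1979] J.-P. Serre, *Local Fields*, GTM 67 (1979): Ch. III §3 Prop. 7 (trace of the integers of a ramified extension), Ch. III §6 Prop. 12, Ch. V §3 Cor. 3.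
* [Rogawski1990] J. D. Rogawski, *Automorphic Representations of Unitary Groups in Three Variables*, Ann. of Math. Stud. 123 (1990): §4.9 Lemma 4.9.3 p. 56.
* [Kottwitz1986BaseChangeUnits] R. E. Kottwitz, *Base change for unit elements of Hecke algebras*, Compositio Math. 60 (1986): §1 pp. 240–241.
-/

set_option autoImplicit false

noncomputable section

namespace Summit.HodgeConjecture.HodgeConjecture.Cruxes.H413.F0P3cDyRamUnrKNoThetaFixedChart

open scoped Valued WithZero
open WithZero

variable {M : Type} [Field M] [Valued M ℤᵐ⁰] {ρ Θ : M →+* M} {α : M}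

/-! ## §1 `Θρ` is residually trivial on type U -/

/-- **`Θρ` IS RESIDUALLY TRIVIAL ON TYPE U**: for every integral `z`, `|Θ(ρz) − z| < 1`.  Coordinates `z = p + q·α` over `Fix ρ` (`q = (z − ρz)∕(α − ρα)` integral by
`_hint`); then `Θ(ρz) − z = (Θp − p) + (Θq − q)·Θ(ρα) + q·(Θ(ρα) − α)` and each term is `< 1` by `_hσres`, `_hσres`, `_hτ` (`Θ(ρα) − α = Θ(ρα − Θα)`).
[cite: Serre1979, Ch. III §6 Prop. 12] -/
theorem v_theta_rho_sub_self_lt_one (hρρ : ∀ x, ρ (ρ x) = x) (hvρ : ∀ x, Valued.v (ρ x) = Valued.v x)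
    (hΘΘ : ∀ x, Θ (Θ x) = x) (hvΘ : ∀ x, Valued.v (Θ x) = Valued.v x)
    (hα : ρ α ≠ α) (hα1 : Valued.v α ≤ 1) (hint : ∀ z : M, Valued.v z ≤ 1 → Valued.v ((z - ρ z) / (α - ρ α)) ≤ 1)
    (hτ : Valued.v (ρ α - Θ α) < 1) (hσres : ∀ z : M, ρ z = z → Valued.v z ≤ 1 → Valued.v (Θ z - z) < 1)
    {z : M} (hz : Valued.v z ≤ 1) : Valued.v (Θ (ρ z) - z) < 1 := by
  have hα0 : α - ρ α ≠ 0 := sub_ne_zero.2 (Ne.symm hα)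
  -- coordinates over `Fix ρ` (opaque names `q`, `p`)
  obtain ⟨q, hq⟩ : ∃ q : M, q = (z - ρ z) / (α - ρ α) := ⟨_, rfl⟩
  obtain ⟨p, hp⟩ : ∃ p : M, p = z - q * α := ⟨_, rfl⟩
  have hρq : ρ q = q := by
    rw [hq, map_div₀, map_sub, map_sub, hρρ, hρρ, ← neg_sub z, ← neg_sub α, neg_div_neg_eq]
  have e0 : z - ρ z = q * (α - ρ α) := by rw [hq, div_mul_cancel₀ _ hα0]
  have hρp : ρ p = p := by
    rw [hp, map_sub, map_mul, hρq]
    linear_combination -e0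
  have hq1 : Valued.v q ≤ 1 := by rw [hq]; exact hint z hz
  have hp1 : Valued.v p ≤ 1 := by
    rw [hp]
    refine (Valuation.map_sub _ _ _).trans (max_le hz ?_)
    rw [Valuation.map_mul]
    exact mul_le_one' hq1 hα1
  have hz' : z = p + q * α := by rw [hp]; ring
  -- the three-term expansion
  have e : Θ (ρ z) - z = (Θ p - p) + (Θ q - q) * Θ (ρ α) + q * (Θ (ρ α) - α) := by
    rw [hz', map_add, map_mul, hρp, hρq, map_add, map_mul]; ring
  have h1 : Valued.v (Θ p - p) < 1 := hσres p hρp hp1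
  have h2 : Valued.v ((Θ q - q) * Θ (ρ α)) < 1 := by
    rw [Valuation.map_mul, hvΘ, hvρ]
    exact Left.mul_lt_one_of_lt_of_le (hσres q hρq hq1) hα1
  have h3 : Valued.v (q * (Θ (ρ α) - α)) < 1 := by
    have e3 : Θ (ρ α) - α = Θ (ρ α - Θ α) := by rw [map_sub, hΘΘ]
    rw [Valuation.map_mul, mul_comm, e3, hvΘ]
    exact Left.mul_lt_one_of_lt_of_le hτ hq1
  rw [e]
  exact (Valuation.map_add _ _ _).trans_lt (max_lt ((Valuation.map_add _ _ _).trans_lt (max_lt h1 h2)) h3)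

/-! ## §2 HEAD — no integral Θ-fixed point of the line `Tr_ρ = 1` -/

/-- **HEAD — ON TYPE U A Θ-FIXED POINT OF THE LINE `Tr_ρ = 1` IS NEVER INTEGRAL**: `Θκ₀ = κ₀`, `κ₀ + ρκ₀ = 1` ⇒ `1 < |κ₀|`.  For otherwise §1 at `κ₀` gives
`|Θ(ρκ₀) − κ₀| = |1 − 2κ₀| < 1`, whereas `|2κ₀| ≤ |2| < 1` forces `|1 − 2κ₀| = |1| = 1`.  So the chart letters `(hκ₀) (hΘκ₀) (hκ₀1)` of the lane-B per-cell files are jointly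
unsatisfiable in lane A. [cite: Serre1979, Ch. III §3 Prop. 7] [cite: Rogawski1990, §4.9 Lemma 4.9.3 p. 56] -/
theorem one_lt_v_of_theta_fixed_of_add_map_eq_one (hρρ : ∀ x, ρ (ρ x) = x) (hvρ : ∀ x, Valued.v (ρ x) = Valued.v x)
    (hΘΘ : ∀ x, Θ (Θ x) = x) (hvΘ : ∀ x, Valued.v (Θ x) = Valued.v x)
    (hα : ρ α ≠ α) (hα1 : Valued.v α ≤ 1) (hint : ∀ z : M, Valued.v z ≤ 1 → Valued.v ((z - ρ z) / (α - ρ α)) ≤ 1)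
    (hτ : Valued.v (ρ α - Θ α) < 1) (hσres : ∀ z : M, ρ z = z → Valued.v z ≤ 1 → Valued.v (Θ z - z) < 1)
    (h2 : Valued.v (2 : M) < 1) {κ₀ : M} (hΘκ₀ : Θ κ₀ = κ₀) (hκ₀ : κ₀ + ρ κ₀ = 1) : 1 < Valued.v κ₀ := by
  by_contra hle
  rw [not_lt] at hle
  have hlt := v_theta_rho_sub_self_lt_one hρρ hvρ hΘΘ hvΘ hα hα1 hint hτ hσres hle
  have hρκ : ρ κ₀ = 1 - κ₀ := by linear_combination hκ₀
  have e : Θ (ρ κ₀) - κ₀ = 1 - 2 * κ₀ := by rw [hρκ, map_sub, map_one, hΘκ₀]; ring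
  rw [e] at hlt
  have h2κ : Valued.v (2 * κ₀) < Valued.v (1 : M) := by
    rw [Valuation.map_mul, Valuation.map_one]
    exact Left.mul_lt_one_of_lt_of_le h2 hle
  have h1 : Valued.v ((1 : M) - 2 * κ₀) = 1 := by
    rw [Valuation.map_sub_eq_of_lt_left _ h2κ, Valuation.map_one]
  exact absurd h1 (ne_of_lt hlt)

/-! ## §3 The negated chart letters -/

/-- **NO INTEGRAL Θ-FIXED CHART ON TYPE U**: `¬ ∃ κ₀, κ₀ + ρκ₀ = 1 ∧ Θκ₀ = κ₀ ∧ |κ₀| ≤ 1` — the first three conjuncts of ★ `…RowInsideChartLetters.exists_rowInsideChart_letters`'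
conclusion (and the letters `hκ₀ hΘκ₀ hκ₀1` of ★ `…UpperRayCellLetters.exists_cellLetters` ∕ ★ `…LowerLineCellLetters`), REFUTED under the type-U frame letters.
[cite: Serre1979, Ch. III §3 Prop. 7] [cite: Kottwitz1986BaseChangeUnits, §1 pp. 240–241] -/
theorem not_exists_theta_fixed_integral_chart (hρρ : ∀ x, ρ (ρ x) = x) (hvρ : ∀ x, Valued.v (ρ x) = Valued.v x)
    (hΘΘ : ∀ x, Θ (Θ x) = x) (hvΘ : ∀ x, Valued.v (Θ x) = Valued.v x)
    (hα : ρ α ≠ α) (hα1 : Valued.v α ≤ 1) (hint : ∀ z : M, Valued.v z ≤ 1 → Valued.v ((z - ρ z) / (α - ρ α)) ≤ 1)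
    (hτ : Valued.v (ρ α - Θ α) < 1) (hσres : ∀ z : M, ρ z = z → Valued.v z ≤ 1 → Valued.v (Θ z - z) < 1)
    (h2 : Valued.v (2 : M) < 1) :
    ¬ ∃ κ₀ : M, κ₀ + ρ κ₀ = 1 ∧ Θ κ₀ = κ₀ ∧ Valued.v κ₀ ≤ 1 := by
  rintro ⟨κ₀, hκ₀, hΘκ₀, hκ₀1⟩
  exact absurd hκ₀1 (not_le.2 (one_lt_v_of_theta_fixed_of_add_map_eq_one hρρ hvρ hΘΘ hvΘ hα hα1 hint hτ hσres h2 hΘκ₀ hκ₀))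

/-! ## §4 In the two-field currency of ‹OFF-A.letter.v2› -/

/-- **THE SAME, FROM ‹OFF-A.letter.v2›'s LETTERS BY NAME**: `jE` isometric, `_h2 : ¬ IsUnit (2 : 𝒪[E])` (so `|2|_M = |jE 2| < 1`), and the type-U `M`-letters
`_hρρ _hvρ _hΘΘ _hvΘ _hα _hα1 _hint _hτ _hσres` ⇒ no `κ₀ : M` with `κ₀ + ρκ₀ = 1`, `Θκ₀ = κ₀`, `|κ₀| ≤ 1`.  (Drop-in for any lane-A payer that meets a lane-B chart socket.)
[cite: Serre1979, Ch. III §3 Prop. 7] [cite: Kottwitz1986BaseChangeUnits, §1 pp. 240–241] -/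
theorem not_exists_theta_fixed_integral_chart_of_letters {E : Type} [Field E] [Valued E ℤᵐ⁰]
    (h2E : ¬ IsUnit (2 : 𝒪[E])) (jE : E →+* M) (hjiso : ∀ a, Valued.v (jE a) = Valued.v a)
    (hρρ : ∀ x, ρ (ρ x) = x) (hvρ : ∀ x, Valued.v (ρ x) = Valued.v x)
    (hΘΘ : ∀ x, Θ (Θ x) = x) (hvΘ : ∀ x, Valued.v (Θ x) = Valued.v x)
    (hα : ρ α ≠ α) (hα1 : Valued.v α ≤ 1) (hint : ∀ z : M, Valued.v z ≤ 1 → Valued.v ((z - ρ z) / (α - ρ α)) ≤ 1)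
    (hτ : Valued.v (ρ α - Θ α) < 1) (hσres : ∀ z : M, ρ z = z → Valued.v z ≤ 1 → Valued.v (Θ z - z) < 1) :
    ¬ ∃ κ₀ : M, κ₀ + ρ κ₀ = 1 ∧ Θ κ₀ = κ₀ ∧ Valued.v κ₀ ≤ 1 := by
  have h2v : Valued.v (2 : E) < 1 := by exact_mod_cast Valuation.Integer.not_isUnit_iff_valuation_lt_one.mp h2E
  have h2 : Valued.v (2 : M) < 1 := by rw [← map_ofNat jE 2, hjiso]; exact h2v
  exact not_exists_theta_fixed_integral_chart hρρ hvρ hΘΘ hvΘ hα hα1 hint hτ hσres h2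

end Summit.HodgeConjecture.HodgeConjecture.Cruxes.H413.F0P3cDyRamUnrKNoThetaFixedChart

end
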